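import Mathlib
import Literature.Analysis.FluidPDE.PoincareBall
import Literature.Analysis.FluidPDE.SuitableWeakRescaling
import Literature.Analysis.FluidPDE.SereginSverakPressureProofs
import Literature.Analysis.FluidPDE.BlowupFarField
import Literature.Analysis.FluidPDE.SereginSverak2002VertexBlowupLimit
import Literature.Analysis.FluidPDE.NSSuitableESS
import Literature.Analysis.FluidPDE.ESSLocalHolderHolds
import Literature.Analysis.FluidPDE.ESSLocalHolderBlowupLimit
import Literature.Analysis.FluidPDE.LocalTypeIScaling
import Literature.Analysis.FluidPDE.LocalTypeIPersistenceHolds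
import Literature.Analysis.FluidPDE.LocalTypeICongr
import Literature.Analysis.FluidPDE.LeraySuitableWeakSolutions
import Literature.Analysis.FluidPDE.NSWeakStrongUniquenessHolds
import Literature.Analysis.FluidPDE.TaoLocalisationHolds
import Literature.Analysis.FluidPDE.TaoLocalisationProofs
import Literature.Analysis.FluidPDE.KatoMaximalTimeSingular
import Literature.Analysis.FluidPDE.TypeIRateScaledEnergyBound
import Summits.NavierStokesRegularity.NavierStokesRegularity.Theorems.TypeIQuarterGateScarZoomDefs
import Summits.NavierStokesRegularity.NavierStokesRegularity.Theorems.TypeIQuarterGateSliceBudgetV7Defs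
import Summits.NavierStokesRegularity.NavierStokesRegularity.Theorems.TypeIQuarterGateScarEnvelopeTypeIBlowupIsCompact
import Literature.Analysis.FluidPDE.SereginSverak2002PressureLowerBoundProofs
import Literature.Analysis.FluidPDE.NSLerayHopfABCScaling
import Literature.Analysis.FluidPDE.NSTimeRescaleClassical
import Literature.Analysis.FluidPDE.NSViscosityRescaling
import Summits.NavierStokesRegularity.NavierStokesRegularity.Theorems.TypeIQuarterGateSliceBudgetDefs
import Literature.Analysis.FluidPDE.TypeIAncientMildRescale
import Literature.Analysis.FluidPDE.SelfSimilar

/-!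
# Zoom dictionary for crux `ScarEnvelopeTypeI` (stmt-NavierStokesRegularity-23843) — DEFINITIONS (Parts A–J)

DEFINITIONS ONLY (objects and fact-shaped `Prop`s of the dictionary, Parts A–J of the plate): octaves and
annular cubes, zooms, the slice budget `BudgetAt`, abstract dictionary inputs I0–I3, backward cylinders, concrete
tangent flows `TangentU`/`TangentOf` (the conclusion shape of the tree's `SuitableCompactness`), the `ν = 1`
fact shapes `PersistenceU`/`LocalESSU` (both PROVED in the theorem modules from the tree's
`PersistenceOfSingularities_holds` / `ess_local_holder_holds`), unit/viscosity normalisation constants, `RegPt`,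
`NoSatellite`; plus the two `rfl`-level identifications `zoom_eq_smul_stPull`, `zoomP_eq_smul_stPull` with the
tree's `stPull`.  Nothing else is asserted here.

PROVENANCE: declaration texts VERBATIM from the HOME plate `round-31/Tangent31prep.lean` v4 (sha16
`013b26365b5cdf0a`; = ROUND-30 plate v10 + Part K) of the instrument seat nsreg-p3 (g24/g25, cell
`pub/ns-regularity-ideate`), who cannot write under `Theorems/` (`perm.theorems-prover-only`); landed by the
LEAD-lineage prover ns-sz-p1 g5 on director-ns DIRECTOR-NS #218 (2), split into ≤ 400-line modules (the
plate's `def`s gathered in `TypeIQuarterGateScarEnvelopeTypeIZoomDictionaryDefs`), namespace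
`Summit.NavierStokesRegularity.NavierStokesRegularity.Cruxes.ScarEnvelopeTypeI.ZoomDictionary` (the plate's `NsregP3.R30P`), `E3` spelled out, one-line docstrings
added where the plate had none.  `--supports stmt-NavierStokesRegularity-23843 --as helper`.
REVIEW p632872 (revise) applied: only the dependency cone of Parts D–K is landed (206 of 240 declarations) —
the general-`ν` abstract dictionary in a second cylinder currency (`bCyl`/`bCylOpens`/`RegAt`/`TangentC`, the
fact-shaped hypotheses F1–F3 and `dictionary`/`…_of_vertexBounds`/`…_of_classical` of Parts B2/B4/C) is NOT
landed; the three remaining uses of the plate's `bCyl y r` are the literal `Ioo (-(r^2)) 0 ×ˢ ball y r` with the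
conversion `Ioo_prod_ball_eq_parabolicCylinder` to the tree's `parabolicCylinder`; ONE final-time regularity
notion `RegPt`; `zoom_eq_smul_stPull`/`zoomP_eq_smul_stPull` sit next to `zoom`/`zoomP` in the Defs module.

HONEST FRAMING: dictionary / census TOOLING for the crux `TypeIQuarterGate.ScarEnvelopeTypeI` (item 23843):
equivalences and normal forms, kernel-checked; NO open statement is proved — 23843, its parent
`QuarterLawTypeI` (23726), the route and Navier–Stokes regularity are OPEN; hard core evaded: none.
-/

noncomputable section

-- the summit-side namespace repeats a component by design (single-conjunct summit, D-0017)
set_option linter.dupNamespace false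

open MeasureTheory Set Metric Filter Topology
open scoped ENNReal

namespace Summit.NavierStokesRegularity.NavierStokesRegularity.Cruxes.ScarEnvelopeTypeI.ZoomDictionary

variable {u : ℝ → (EuclideanSpace ℝ (Fin 3)) → (EuclideanSpace ℝ (Fin 3))} {a : (EuclideanSpace ℝ (Fin 3))} {ν T : ℝ}

/-- The e-annulus `{ℓ < ‖y − a‖ < e·ℓ}` about `a` at radius `ℓ` (SD's octave). [folklore] -/
def octAnn (a : (EuclideanSpace ℝ (Fin 3))) (ℓ : ℝ) : Set (EuclideanSpace ℝ (Fin 3)) := {y | ℓ < ‖y - a‖ ∧ ‖y - a‖ < Real.exp 1 * ℓ}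

/-- The annular cube `∫_{ℓ<‖y−a‖<eℓ} ‖u(t,y)‖³ dy ∈ [0,∞]` — SD's integrand verbatim. [folklore] -/
noncomputable def octaveCube (u : ℝ → (EuclideanSpace ℝ (Fin 3)) → (EuclideanSpace ℝ (Fin 3))) (a : (EuclideanSpace ℝ (Fin 3))) (ℓ t : ℝ) : ℝ≥0∞ :=
  ∫⁻ y in octAnn a ℓ, ‖u t y‖ₑ ^ (3 : ℝ)

/-- The Navier–Stokes zoom `(zoom u a T ℓ)(s,y) = ℓ • u(T + ℓ²s, a + ℓ•y)` at `(T,a)`, scale `ℓ`. [folklore] -/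
noncomputable def zoom (u : ℝ → (EuclideanSpace ℝ (Fin 3)) → (EuclideanSpace ℝ (Fin 3))) (a : (EuclideanSpace ℝ (Fin 3))) (T ℓ : ℝ) : ℝ → (EuclideanSpace ℝ (Fin 3)) → (EuclideanSpace ℝ (Fin 3)) :=
  fun s y => ℓ • u (T + ℓ ^ 2 * s) (a + ℓ • y)

/-- The closed unit annulus `{1 ≤ |y| ≤ e}` (the final-time screen of the zooms). -/
def unitAnn : Set (EuclideanSpace ℝ (Fin 3)) := (fun y : (EuclideanSpace ℝ (Fin 3)) => ‖y‖) ⁻¹' Icc 1 (Real.exp 1)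

/-- SD at one point: the body of the tree's `OctaveBudget`. -/
def BudgetAt (ν T : ℝ) (u : ℝ → (EuclideanSpace ℝ (Fin 3)) → (EuclideanSpace ℝ (Fin 3))) (a : (EuclideanSpace ℝ (Fin 3))) : Prop :=
  ∃ q δ r₀ : ℝ, 0 < δ ∧ 0 < r₀ ∧ ∀ t ∈ Ioo (T - δ) T, ∀ ℓ : ℝ,
    Real.sqrt (ν * (T - t)) ≤ ℓ → ℓ ≤ r₀ → octaveCube u a ℓ t ≤ ENNReal.ofReal q

/-- I0: tangent flows are taken along positive null sequences of scales. -/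
def I0 (Tangent : (ℕ → ℝ) → (ℝ → (EuclideanSpace ℝ (Fin 3)) → (EuclideanSpace ℝ (Fin 3))) → Prop) : Prop :=
  ∀ ℓ ū, Tangent ℓ ū → (∀ k, 0 < ℓ k) ∧ Tendsto ℓ atTop (𝓝 0)

/-- I1 (compactness of the zooms): every positive null sequence has a subsequence with a tangent flow. -/
def I1 (Tangent : (ℕ → ℝ) → (ℝ → (EuclideanSpace ℝ (Fin 3)) → (EuclideanSpace ℝ (Fin 3))) → Prop) : Prop :=
  ∀ ℓ : ℕ → ℝ, (∀ k, 0 < ℓ k) → Tendsto ℓ atTop (𝓝 0) →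
    ∃ φ : ℕ → ℕ, StrictMono φ ∧ ∃ ū, Tangent (ℓ ∘ φ) ū

/-- I2 (stability of regular points, ε-regularity of the first kind): near a regular final-time
point of a tangent flow the zooms are eventually uniformly bounded. -/
def I2 (u : ℝ → (EuclideanSpace ℝ (Fin 3)) → (EuclideanSpace ℝ (Fin 3))) (a : (EuclideanSpace ℝ (Fin 3))) (T : ℝ) (Reg : (ℝ → (EuclideanSpace ℝ (Fin 3)) → (EuclideanSpace ℝ (Fin 3))) → (EuclideanSpace ℝ (Fin 3)) → Prop)
    (Tangent : (ℕ → ℝ) → (ℝ → (EuclideanSpace ℝ (Fin 3)) → (EuclideanSpace ℝ (Fin 3))) → Prop) : Prop :=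
  ∀ ℓ ū, ∀ y ∈ unitAnn, Tangent ℓ ū → Reg ū y →
    ∃ ρ : ℝ, 0 < ρ ∧ ∃ M : ℝ, ∀ᶠ k in atTop,
      ∀ s ∈ Ioo (-(ρ ^ 2)) 0, ∀ z ∈ ball y ρ, ‖zoom u a T (ℓ k) s z‖ ≤ M

/-- I3 (local ESS after Fatou): eventually-uniform octave-`L³` bounds of the zooms on a
neighbourhood of the unit annulus, on a final time window, make every point of the closed unit
annulus a regular final-time point of the tangent flow. -/
def I3 (u : ℝ → (EuclideanSpace ℝ (Fin 3)) → (EuclideanSpace ℝ (Fin 3))) (a : (EuclideanSpace ℝ (Fin 3))) (T : ℝ) (Reg : (ℝ → (EuclideanSpace ℝ (Fin 3)) → (EuclideanSpace ℝ (Fin 3))) → (EuclideanSpace ℝ (Fin 3)) → Prop)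
    (Tangent : (ℕ → ℝ) → (ℝ → (EuclideanSpace ℝ (Fin 3)) → (EuclideanSpace ℝ (Fin 3))) → Prop) : Prop :=
  ∀ ℓ ū, Tangent ℓ ū →
    (∃ q τ : ℝ, 0 < τ ∧ ∀ᶠ k in atTop, ∀ s ∈ Ioo (-τ) 0, ∀ r ∈ Icc (1 / 2 : ℝ) 2,
        octaveCube (zoom u a T (ℓ k)) 0 r s ≤ ENNReal.ofReal q) →
    ∀ y ∈ unitAnn, Reg ū y

/-- The Type-I bound read on the zooms (scale-invariant): `|u_ℓ(s, z)| ≤ C₀/√(-s)` on the final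
window, for all small scales. -/
def TypeIOnZooms (ν : ℝ) (u : ℝ → (EuclideanSpace ℝ (Fin 3)) → (EuclideanSpace ℝ (Fin 3))) (a : (EuclideanSpace ℝ (Fin 3))) (T : ℝ) : Prop :=
  ∃ C₀ ℓ₀ : ℝ, 0 < ℓ₀ ∧ ∀ ℓ, 0 < ℓ → ℓ ≤ ℓ₀ →
    ∀ s ∈ Ico (-(1 / ν)) 0, ∀ z, ‖zoom u a T ℓ s z‖ ≤ C₀ / Real.sqrt (-s)

/-- The zoomed pressure `p^{(ℓ)}(s,y) = ℓ² p(T + ℓ² s, a + ℓ y)`. -/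
noncomputable def zoomP (p : ℝ → (EuclideanSpace ℝ (Fin 3)) → ℝ) (a : (EuclideanSpace ℝ (Fin 3))) (T ℓ : ℝ) : ℝ → (EuclideanSpace ℝ (Fin 3)) → ℝ :=
  fun s y => ℓ ^ 2 * p (T + ℓ ^ 2 * s) (a + ℓ • y)

/-- The window radius: `R₀ ≥ 3e` (covers a unit neighbourhood of the closed unit annulus) and
`R₀² ≥ 2/ν` (covers the admissible time window `[-1/ν, 0)` of the zooms). -/
noncomputable def R₀ (ν : ℝ) : ℝ := 3 * Real.exp 1 + Real.sqrt (2 / ν)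

section Rescaling

open Literature.Analysis.FluidPDE
variable {u : ℝ → (EuclideanSpace ℝ (Fin 3)) → (EuclideanSpace ℝ (Fin 3))} {p : ℝ → (EuclideanSpace ℝ (Fin 3)) → ℝ} {a : (EuclideanSpace ℝ (Fin 3))} {ν T : ℝ}

/-- The zoom is the tree's space–time rescaling: `zoom u a T ℓ = ℓ • stPull ℓ² ℓ T a u`. [folklore] -/
theorem zoom_eq_smul_stPull (ℓ : ℝ) : zoom u a T ℓ = ℓ • stPull (ℓ ^ 2) ℓ T a u := by
  funext s y; rfl

/-- The pressure zoom is `ℓ² • stPull ℓ² ℓ T a p`. [folklore] -/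
theorem zoomP_eq_smul_stPull (ℓ : ℝ) : zoomP p a T ℓ = ℓ ^ 2 • stPull (ℓ ^ 2) ℓ T a p := by
  funext s y; simp [zoomP, stPull_apply, smul_eq_mul]


end Rescaling
section UnitNormalisation

open Literature.Analysis.FluidPDE
variable {u : ℝ → (EuclideanSpace ℝ (Fin 3)) → (EuclideanSpace ℝ (Fin 3))} {p : ℝ → (EuclideanSpace ℝ (Fin 3)) → ℝ} {a : (EuclideanSpace ℝ (Fin 3))} {T : ℝ}

/-- The window factor `c₀ = 2 R₀(1) (> 16)`. -/
noncomputable def c₀ : ℝ := 2 * R₀ 1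

/-- **Tangent flows in the tree's currency.** `ū` is a tangent flow of `u` at `(a, T)` along the
positive null scales `L`: for some pressure `p̄`, on every ball `Q_R(0)`, `R < 1`, the pair
`(ū, p̄)` is a suitable weak solution in A–B's class, `ū ∈ L³`, the zooms `u^{(L_k)}` converge to
`ū` in `L³(Q_R)` and the zoomed pressures converge weakly (against `L³(Q_R)`) to `p̄` — verbatim
the conclusion of `Literature.Analysis.FluidPDE.SuitableCompactness`. -/
def TangentU (u : ℝ → (EuclideanSpace ℝ (Fin 3)) → (EuclideanSpace ℝ (Fin 3))) (p : ℝ → (EuclideanSpace ℝ (Fin 3)) → ℝ) (a : (EuclideanSpace ℝ (Fin 3))) (T : ℝ) (L : ℕ → ℝ)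
    (ū : ℝ → (EuclideanSpace ℝ (Fin 3)) → (EuclideanSpace ℝ (Fin 3))) : Prop :=
  (∀ k, 0 < L k) ∧ Tendsto L atTop (𝓝 0) ∧ ∃ pbar : ℝ → (EuclideanSpace ℝ (Fin 3)) → ℝ, ∀ R ∈ Ioo (0 : ℝ) 1,
    IsSuitableWeakSolutionInBall R 0 ū pbar ∧
    MemLp (Function.uncurry ū) 3 (volume.restrict (parabolicCylinder R (0 : ℝ × (EuclideanSpace ℝ (Fin 3))))) ∧
    Tendsto (fun k => eLpNorm (Function.uncurry (zoom u a T (L k)) - Function.uncurry ū) 3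
      (volume.restrict (parabolicCylinder R (0 : ℝ × (EuclideanSpace ℝ (Fin 3)))))) atTop (𝓝 0) ∧
    ∀ g : ℝ × (EuclideanSpace ℝ (Fin 3)) → ℝ, MemLp g 3 (volume.restrict (parabolicCylinder R (0 : ℝ × (EuclideanSpace ℝ (Fin 3))))) →
      Tendsto (fun k => ∫ w in parabolicCylinder R (0 : ℝ × (EuclideanSpace ℝ (Fin 3))), zoomP p a T (L k) w.1 w.2 * g w)
        atTop (𝓝 (∫ w in parabolicCylinder R (0 : ℝ × (EuclideanSpace ℝ (Fin 3))), pbar w.1 w.2 * g w))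

/-- The tangent-flow relation fed to Part A: scales `ℓ`, zooms recorded at scale `c₀ ℓ`. -/
def TangentOf (u : ℝ → (EuclideanSpace ℝ (Fin 3)) → (EuclideanSpace ℝ (Fin 3))) (p : ℝ → (EuclideanSpace ℝ (Fin 3)) → ℝ) (a : (EuclideanSpace ℝ (Fin 3))) (T : ℝ) (ℓ : ℕ → ℝ)
    (ū : ℝ → (EuclideanSpace ℝ (Fin 3)) → (EuclideanSpace ℝ (Fin 3))) : Prop :=
  TangentU u p a T (fun k => c₀ * ℓ k) ū

/-- Final-time regularity of a unit-normalised tangent flow at the point corresponding to `y`: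
essential boundedness on a backward cylinder at `(0, c₀⁻¹ y)`. -/
def RegU (ū : ℝ → (EuclideanSpace ℝ (Fin 3)) → (EuclideanSpace ℝ (Fin 3))) (y : (EuclideanSpace ℝ (Fin 3))) : Prop :=
  ∃ r : ℝ, 0 < r ∧ ∃ M : ℝ,
    ∀ᵐ z ∂(volume.restrict (parabolicCylinder r ((0 : ℝ), c₀⁻¹ • y))), ‖ū z.1 z.2‖ ≤ M

/-- Small zooms are suitable weak solutions in the unit parabolic ball (A–B class). -/
def ZoomsInBall (u : ℝ → (EuclideanSpace ℝ (Fin 3)) → (EuclideanSpace ℝ (Fin 3))) (p : ℝ → (EuclideanSpace ℝ (Fin 3)) → ℝ) (a : (EuclideanSpace ℝ (Fin 3))) (T : ℝ) : Prop :=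
  ∃ L₁ : ℝ, 0 < L₁ ∧ ∀ L : ℝ, 0 < L → L ≤ L₁ →
    IsSuitableWeakSolutionInBall 1 0 (zoom u a T L) (zoomP p a T L)

/-- Small zooms are uniformly bounded in `L³ × L^{3/2}(Q₁(0))`. -/
def ZoomsBddU (u : ℝ → (EuclideanSpace ℝ (Fin 3)) → (EuclideanSpace ℝ (Fin 3))) (p : ℝ → (EuclideanSpace ℝ (Fin 3)) → ℝ) (a : (EuclideanSpace ℝ (Fin 3))) (T : ℝ) : Prop :=
  ∃ C : ℝ≥0∞, C < ⊤ ∧ ∃ L₁ : ℝ, 0 < L₁ ∧ ∀ L : ℝ, 0 < L → L ≤ L₁ →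
    eLpNorm (Function.uncurry (zoom u a T L)) 3
        (volume.restrict (parabolicCylinder 1 (0 : ℝ × (EuclideanSpace ℝ (Fin 3))))) +
      eLpNorm (Function.uncurry (zoomP p a T L)) (3 / 2)
        (volume.restrict (parabolicCylinder 1 (0 : ℝ × (EuclideanSpace ℝ (Fin 3))))) ≤ C

/-- FACT-SHAPE (A–B Prop. 2.3 / Rusin–Šverák 2011 Lemmas 2.1–2.2, contrapositive, at centre
`(0, y)` and radius `ρ`): suitable weak solutions in `Q_ρ(0,y)` with the uniform `L³ × L^{3/2}`
bound, converging in `L³(Q_ρ(0,y))` (pressures weakly) to a suitable weak solution which is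
essentially bounded near `(0, y)`, are eventually uniformly essentially bounded near `(0, y)`.
PROVED in the theorem module `…ZoomDictionaryPersistence` (`persistenceU_holds`), from the tree theorem `PersistenceOfSingularities_holds` after
`IsSuitableWeakSolutionInBall.zoom`, with `IsBackwardSingularPoint` unfolded. -/
def PersistenceU : Prop :=
  ∀ (v : ℕ → ℝ → (EuclideanSpace ℝ (Fin 3)) → (EuclideanSpace ℝ (Fin 3))) (q : ℕ → ℝ → (EuclideanSpace ℝ (Fin 3)) → ℝ) (ū : ℝ → (EuclideanSpace ℝ (Fin 3)) → (EuclideanSpace ℝ (Fin 3))) (pbar : ℝ → (EuclideanSpace ℝ (Fin 3)) → ℝ) (y : (EuclideanSpace ℝ (Fin 3)))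
    (ρ : ℝ), 0 < ρ →
    (∀ k, IsSuitableWeakSolutionInBall ρ ((0 : ℝ), y) (v k) (q k)) →
    IsSuitableWeakSolutionInBall ρ ((0 : ℝ), y) ū pbar →
    (⨆ k, eLpNorm (Function.uncurry (v k)) 3
        (volume.restrict (parabolicCylinder ρ ((0 : ℝ), y))) +
      eLpNorm (Function.uncurry (q k)) (3 / 2)
        (volume.restrict (parabolicCylinder ρ ((0 : ℝ), y)))) < ⊤ →
    Tendsto (fun k => eLpNorm (Function.uncurry (v k) - Function.uncurry ū) 3
      (volume.restrict (parabolicCylinder ρ ((0 : ℝ), y)))) atTop (𝓝 0) →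
    (∀ g : ℝ × (EuclideanSpace ℝ (Fin 3)) → ℝ, MemLp g 3 (volume.restrict (parabolicCylinder ρ ((0 : ℝ), y))) →
      Tendsto (fun k => ∫ w in parabolicCylinder ρ ((0 : ℝ), y), q k w.1 w.2 * g w) atTop
        (𝓝 (∫ w in parabolicCylinder ρ ((0 : ℝ), y), pbar w.1 w.2 * g w))) →
    (∃ r : ℝ, 0 < r ∧ ∃ M : ℝ,
      ∀ᵐ z ∂(volume.restrict (parabolicCylinder r ((0 : ℝ), y))), ‖ū z.1 z.2‖ ≤ M) →
    ∃ r : ℝ, 0 < r ∧ ∃ M : ℝ, ∀ᶠ k in atTop,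
      ∀ᵐ z ∂(volume.restrict (parabolicCylinder r ((0 : ℝ), y))), ‖v k z.1 z.2‖ ≤ M

/-- FACT-SHAPE (Escauriaza–Seregin–Šverák 2003, Thm 1.4, at centre `(0, y)`, radius `ρ`,
`ν = 1`, essential-bound form): a suitable weak solution in `Q_ρ(0,y)` (A–B class) with
`ess sup_s ‖v(s)‖_{L³(B_ρ(y))} < ∞` is essentially bounded on `Q_{ρ/2}(0,y)`.
PROVED in the theorem module `…ZoomDictionaryUnit` (`localESSU_holds`), from the tree theorem `ess_local_holder_holds` through
`IsL3inftyLocalPair.exists_ae_bound`. -/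
def LocalESSU : Prop :=
  ∀ (v : ℝ → (EuclideanSpace ℝ (Fin 3)) → (EuclideanSpace ℝ (Fin 3))) (q : ℝ → (EuclideanSpace ℝ (Fin 3)) → ℝ) (y : (EuclideanSpace ℝ (Fin 3))) (ρ : ℝ), 0 < ρ →
    IsSuitableWeakSolutionInBall ρ ((0 : ℝ), y) v q →
    (∃ C : ℝ≥0∞, C < ⊤ ∧ ∀ᵐ s ∂(volume.restrict (Ioo (-(ρ ^ 2)) 0)),
      ∫⁻ x in ball y ρ, ‖v s x‖ₑ ^ (3 : ℝ) ≤ C) →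
    ∃ M : ℝ, ∀ᵐ z ∂(volume.restrict (parabolicCylinder (ρ / 2) ((0 : ℝ), y))), ‖v z.1 z.2‖ ≤ M

/-- Essential boundedness of a field near the final-time point `(0, y)` (no `c₀` factor). -/
def RegPt (ū : ℝ → (EuclideanSpace ℝ (Fin 3)) → (EuclideanSpace ℝ (Fin 3))) (y : (EuclideanSpace ℝ (Fin 3))) : Prop :=
  ∃ r : ℝ, 0 < r ∧ ∃ M : ℝ,
    ∀ᵐ z ∂(volume.restrict (parabolicCylinder r ((0 : ℝ), y))), ‖ū z.1 z.2‖ ≤ M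


end UnitNormalisation
section ViscosityNormalisation

open Literature.Analysis.FluidPDE
variable {u : ℝ → (EuclideanSpace ℝ (Fin 3)) → (EuclideanSpace ℝ (Fin 3))} {p : ℝ → (EuclideanSpace ℝ (Fin 3)) → ℝ} {a : (EuclideanSpace ℝ (Fin 3))} {ν T : ℝ}

/-- **Satellite-freeness** of the Type-I blow-up `(u, T)` with viscosity `ν` (unit-viscosity
rescaling `v = timeRescale ν⁻¹ ν⁻¹ u`, final time `νT`): at every singular point, for every admissible
pressure, every tangent flow is essentially bounded near every final-time point off the axis in
its domain. -/
def NoSatellite (ν T : ℝ) (u : ℝ → (EuclideanSpace ℝ (Fin 3)) → (EuclideanSpace ℝ (Fin 3))) : Prop :=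
  ∀ a, Summit.NavierStokesRegularity.NavierStokesRegularity.Cruxes.ScarEnvelopeTypeI.SliceBudget.SingularPt
      (ν * T) (timeRescale ν⁻¹ ν⁻¹ u) a →
    ∀ q : ℝ → (EuclideanSpace ℝ (Fin 3)) → ℝ, ZoomsInBall (timeRescale ν⁻¹ ν⁻¹ u) q a (ν * T) →
      ZoomsBddU (timeRescale ν⁻¹ ν⁻¹ u) q a (ν * T) →
        ∀ L ū, TangentU (timeRescale ν⁻¹ ν⁻¹ u) q a (ν * T) L ū →
          ∀ y' : (EuclideanSpace ℝ (Fin 3)), y' ≠ 0 → ‖y'‖ < 1 → RegPt ū y'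


end ViscosityNormalisation

end Summit.NavierStokesRegularity.NavierStokesRegularity.Cruxes.ScarEnvelopeTypeI.ZoomDictionary

end
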